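import Mathlib
import HarnessLib
import Literature.MathematicalPhysics.StatisticalMechanics.LennardJonesClusters
import Summits.AtomisticToContinuum.Crystallization.Theorems.ContactSaturationLadderWindowFloor
import Summits.AtomisticToContinuum.Crystallization.Theorems.ContactSaturationLadderDilationCharge
import Summits.AtomisticToContinuum.Crystallization.Theorems.ContactSaturationLadderStretchBound

/-!
# ContactSaturationLadder · `LooseTextureRung` (stmt-AtomisticToContinuum-30303) — the DIRECTIONAL CHARGE of a sub-window

Helper module for the crux `Summit.AtomisticToContinuum.Crystallization.Theses.ContactSaturationLadder.LooseTextureRung`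
(registered skeleton v6.3 «DialFreeSieveV6», stub `stub_corelessLaw6` = the CORELESS LAW CL `∃ κ > 0 ∃ C, CorelessLawGS 6 κ C`).
It lands RUNG 2 of the STRAIN-MODE ladder beneath CL (decomp-a2c lens-1 g26; critic rows 328 (2)(ii) / 334 «the affine/deviatoric
rung … must be e⋆-free in the same sense»): the companion of `ContactSaturationLadderDilationCharge` (rung 1, the dilatation mode)
for the UNIAXIAL strain modes, again in configuration-free form and with no constant beyond pure numerals.

## What is proved (GS-free §4–§6, GS grade §7; the pair geometry §1–§3 is `ContactSaturationLadderStretchBound`)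

For distinct points `y : Fin N → ℝ³`, ANY index set `W` and ANY unit vector `u` write (ordered pairs inside `W`, `r = |y_i − y_k|`,
`cos² = (⟪u, y_k − y_i⟫/r)²`)
`D₁₂ᵘ(W) = ΣΣ r⁻¹²·cos²`, `D₆ᵘ(W) = ΣΣ r⁻⁶·cos²` (the DIRECTIONAL lattice sums; their traces over an orthonormal frame are `S₁₂, S₆`),
`Vᵘ = D₁₂ᵘ − D₆ᵘ` (the uniaxial virial: `−¼Vᵘ` is the first derivative of `𝓔(y|W) = ½ΣΣ V_LJ` along the stretch `x ↦ x + τ⟪u,x⟫u`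
in the variable `σ = (1+τ)² − 1`), and `e⋆ = ⨅_Q e(Q)`.

* (imported) the PAIR BOUND `ContactSaturationLadderStretchBound.lennardJones_stretch_le` — second-order control of `V_LJ` along
  the stretch `x ↦ x + τ⟪u,x⟫u` without calculus: `V_LJ(|S(a) − S(b)|) ≤ V_LJ(r) + σ·½·cos²·(r⁻⁶ − r⁻¹²) + (49/12)·σ²·cos²·r⁻¹²`
  for `|σ| ≤ 1/10`, `σ = 2τ + τ²`.
* §4 `card_mul_iInf_le_stretch` — THE STRETCH FAMILY OF FLOORS: `#W·e⋆ ≤ 𝓔(y|W) − ¼σ·Vᵘ + (49/24)·σ²·D₁₂ᵘ` for every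
  `σ ∈ [−1/10, 1/10]` (the tree's periodisation floor `card_mul_iInf_le_half_sum` for the stretched configuration, which again
  consists of distinct points, plus the pair bound summed over `W`).
* §5 `directionalCharge_le` — THE DIRECTIONAL CHARGE: optimising `σ`,
      `min (3·(Vᵘ)²/(392·D₁₂ᵘ)) (|Vᵘ|/80) ≤ 𝓔(y|W) − #W·e⋆`
  for EVERY sub-window of EVERY configuration and EVERY direction: the excess over the bulk floor controls every uniaxial virial,
  not only their trace.  `e⋆`-FREE in the critic's sense (row 334 guard): no value, sign or attainment of `e⋆`, no census numeral,
  no separation constant — only the definition of `e⋆` as an infimum over periodic states (the stretched configuration is a competitor).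
* §6 `dirVirial_sq_le_of_separated` — separated form: at separation `δ` (`D₁₂ᵘ ≤ S₁₂ ≤ 250δ⁻¹²#W`, `D₆ᵘ ≤ S₆ ≤ 250δ⁻⁶#W`),
      `(D₁₂ᵘ(W) − D₆ᵘ(W))² ≤ 33000·(δ⁻¹² + δ⁻⁶)·#W·(𝓔(y|W) − #W·e⋆)`;
  at the ground-state separation `7/10` this is the lens-1 node's typed rung `DirectionalChargeLaw K₀` with the explicit
  `K₀ = 33000·((10/7)¹² + (10/7)⁶)`.
* §7 GS GRADE `gsWindowDirVirial_small` — LOCAL ZERO DEVIATORIC STRESS: for every `ε > 0` there is `ρ₁` such that for all `ρ ≥ ρ₁`,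
  every Lennard-Jones ground state, every centre `p` and every unit vector `u`, `|D₁₂ᵘ(B(p,ρ)) − D₆ᵘ(B(p,ρ))| ≤ ε·(#B + ρ³)`
  (from §6 and the excess ceiling `gsWindow_excess_virial` of the rung-1 module).  With rung 1's local zero pressure: the entire
  window-averaged FIRST-ORDER (affine) strain response of a ground-state window vanishes at density `o(1) + O(ρ³/#B)` — the
  node's `LocalZeroStressGS`, necessary side of CL at grade 2.

## Why this is rung 2 and not CL
Like the dilation charge, the directional charge prices only WINDOW-AVERAGED (affine) strain: a texture whose directional lattice
sums are balanced window by window in every direction (e.g. a tetrahedrally close-packed phase at its own optimal cell) has zero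
charge in both rungs; pricing those is the chart-level rung 3 (census-gated) and the residual `BalancedCorelessLawGS` of the node.
What the rung buys: competitor/texture arguments for CL may assume `D₁₂ᵘ = D₆ᵘ + O(√(#W·excess))` in every direction on every
sub-window, i.e. the full affine equilibrium of every sub-window up to the square root of its excess.
-/

namespace Summit.AtomisticToContinuum.Crystallization.Theorems.ContactSaturationLadderDirectionalCharge

open scoped BigOperators Classical
open Literature.MathematicalPhysics.StatisticalMechanics (lennardJones IsGroundState PeriodicConfiguration
  LennardJonesMinimalDistance_holds sum_inv_pow_six_le)
open Summit.AtomisticToContinuum.Crystallization.Theorems.ContactSaturationLadderWindowFloor (card_mul_iInf_le_half_sum)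
open Summit.AtomisticToContinuum.Crystallization.Theorems.ContactSaturationLadderDilationCharge (half_sum_lennardJones_eq
  windowExcess_nonneg sum_inv_pow_twelve_le_of_separated sum_inv_pow_eq_zero_iff gsWindow_excess_virial)
open Summit.AtomisticToContinuum.Crystallization.Theorems.ContactSaturationLadderStretchBound (stretch_injective
  dirCos_sq_le_one lennardJones_stretch_le)

/-! ## §4 The stretch family of floors -/

/-- **The window energy along the stretch, to second order.**  For distinct points, a unit vector `u` and `σ = 2τ + τ²`,
`|σ| ≤ 1/10`: `𝓔(S_τ y | W) ≤ 𝓔(y|W) + σ·¼·(D₆ᵘ(W) − D₁₂ᵘ(W)) + (49/24)·σ²·D₁₂ᵘ(W)`, where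
`Dₙᵘ(W) = Σ_{i∈W} Σ_{k∈W∖{i}} |y_i − y_k|⁻ⁿ·(⟪u, y_k − y_i⟫/|y_i − y_k|)²` are the DIRECTIONAL lattice sums. -/
theorem half_sum_stretch_le {N : ℕ} {y : Fin N → EuclideanSpace ℝ (Fin 3)} (hy : Function.Injective y)
    (W : Finset (Fin N)) {u : EuclideanSpace ℝ (Fin 3)} (hu : ‖u‖ = 1) {τ : ℝ} (hσ : |2 * τ + τ ^ 2| ≤ 1 / 10) :
    (1 / 2) * ∑ i ∈ W, ∑ k ∈ W.erase i,
        lennardJones (dist (y i + (τ * inner ℝ u (y i)) • u) (y k + (τ * inner ℝ u (y k)) • u)) ≤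
      (1 / 2) * ∑ i ∈ W, ∑ k ∈ W.erase i, lennardJones (dist (y i) (y k)) +
        (2 * τ + τ ^ 2) * ((1 / 4) *
          ((∑ i ∈ W, ∑ k ∈ W.erase i, (dist (y i) (y k))⁻¹ ^ 6 * (inner ℝ u (y k - y i) / dist (y i) (y k)) ^ 2) -
            ∑ i ∈ W, ∑ k ∈ W.erase i, (dist (y i) (y k))⁻¹ ^ 12 * (inner ℝ u (y k - y i) / dist (y i) (y k)) ^ 2)) +
        (49 / 24) * (2 * τ + τ ^ 2) ^ 2 *
          ∑ i ∈ W, ∑ k ∈ W.erase i, (dist (y i) (y k))⁻¹ ^ 12 * (inner ℝ u (y k - y i) / dist (y i) (y k)) ^ 2 := by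
  set σ : ℝ := 2 * τ + τ ^ 2 with hσdef
  have hterm : ∀ i ∈ W, ∀ k ∈ W.erase i,
      lennardJones (dist (y i + (τ * inner ℝ u (y i)) • u) (y k + (τ * inner ℝ u (y k)) • u)) ≤
        lennardJones (dist (y i) (y k)) +
          (σ / 2) * ((dist (y i) (y k))⁻¹ ^ 6 * (inner ℝ u (y k - y i) / dist (y i) (y k)) ^ 2) -
          (σ / 2) * ((dist (y i) (y k))⁻¹ ^ 12 * (inner ℝ u (y k - y i) / dist (y i) (y k)) ^ 2) +
          ((49 / 12) * σ ^ 2) * ((dist (y i) (y k))⁻¹ ^ 12 * (inner ℝ u (y k - y i) / dist (y i) (y k)) ^ 2) := by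
    intro i _ k hk
    have hik : y i ≠ y k := fun h => (Finset.ne_of_mem_erase hk) (hy h).symm
    have h := lennardJones_stretch_le hu (by rw [← hσdef]; exact hσ) hik
    rw [← hσdef] at h
    linarith
  calc (1 / 2) * ∑ i ∈ W, ∑ k ∈ W.erase i,
          lennardJones (dist (y i + (τ * inner ℝ u (y i)) • u) (y k + (τ * inner ℝ u (y k)) • u))
      ≤ (1 / 2) * ∑ i ∈ W, ∑ k ∈ W.erase i,
          (lennardJones (dist (y i) (y k)) +
            (σ / 2) * ((dist (y i) (y k))⁻¹ ^ 6 * (inner ℝ u (y k - y i) / dist (y i) (y k)) ^ 2) -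
            (σ / 2) * ((dist (y i) (y k))⁻¹ ^ 12 * (inner ℝ u (y k - y i) / dist (y i) (y k)) ^ 2) +
            ((49 / 12) * σ ^ 2) * ((dist (y i) (y k))⁻¹ ^ 12 * (inner ℝ u (y k - y i) / dist (y i) (y k)) ^ 2)) :=
        mul_le_mul_of_nonneg_left (Finset.sum_le_sum fun i hi => Finset.sum_le_sum fun k hk => hterm i hi k hk)
          (by norm_num)
    _ = _ := by
        simp only [Finset.sum_add_distrib, Finset.sum_sub_distrib, ← Finset.mul_sum]
        ring

/-- **The stretch family of floors.**  For distinct points, every index set `W`, every unit vector `u` and every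
`σ ∈ [−1/10, 1/10]`:  `#W·e⋆ ≤ 𝓔(y|W) + σ·¼·(D₆ᵘ − D₁₂ᵘ) + (49/24)·σ²·D₁₂ᵘ`
(the periodisation floor `card_mul_iInf_le_half_sum` for the stretched configuration `S_τ y`, `(1+τ)² = 1 + σ`, which again
consists of distinct points, combined with `half_sum_stretch_le`; `e⋆` enters only as the infimum over periodic states). -/
theorem card_mul_iInf_le_stretch {N : ℕ} {y : Fin N → EuclideanSpace ℝ (Fin 3)} (hy : Function.Injective y)
    (W : Finset (Fin N)) {u : EuclideanSpace ℝ (Fin 3)} (hu : ‖u‖ = 1) {σ : ℝ} (hσ : |σ| ≤ 1 / 10) :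
    (W.card : ℝ) * (⨅ Q : PeriodicConfiguration 3, Q.energyPerParticle lennardJones) ≤
      (1 / 2) * ∑ i ∈ W, ∑ k ∈ W.erase i, lennardJones (dist (y i) (y k)) +
        σ * ((1 / 4) *
          ((∑ i ∈ W, ∑ k ∈ W.erase i, (dist (y i) (y k))⁻¹ ^ 6 * (inner ℝ u (y k - y i) / dist (y i) (y k)) ^ 2) -
            ∑ i ∈ W, ∑ k ∈ W.erase i, (dist (y i) (y k))⁻¹ ^ 12 * (inner ℝ u (y k - y i) / dist (y i) (y k)) ^ 2)) +
        (49 / 24) * σ ^ 2 *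
          ∑ i ∈ W, ∑ k ∈ W.erase i, (dist (y i) (y k))⁻¹ ^ 12 * (inner ℝ u (y k - y i) / dist (y i) (y k)) ^ 2 := by
  obtain ⟨hσ1, hσ2⟩ := abs_le.1 hσ
  have h1σ : 0 ≤ 1 + σ := by linarith
  -- the stretch parameter `τ = √(1+σ) − 1`
  set τ : ℝ := Real.sqrt (1 + σ) - 1 with hτdef
  have h1τ : 1 + τ = Real.sqrt (1 + σ) := by rw [hτdef]; ring
  have hτ0 : 1 + τ ≠ 0 := by
    rw [h1τ]
    exact (Real.sqrt_pos.2 (by linarith)).ne'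
  have h2τ : 2 * τ + τ ^ 2 = σ := by
    have : (1 + τ) ^ 2 = 1 + σ := by rw [h1τ, Real.sq_sqrt h1σ]
    linarith [this]
  have hfloor := card_mul_iInf_le_half_sum (stretch_injective hu hτ0 hy) W
  have hexp := half_sum_stretch_le hy W hu (τ := τ) (by rw [h2τ]; exact hσ)
  rw [h2τ] at hexp
  exact le_trans hfloor hexp

/-! ## §5 The directional charge -/

/-- The one-variable optimisation behind the directional charge: if `0 ≤ X − σ·V/4 + (49/24)·σ²·P` for all `|σ| ≤ 1/10`
(`P ≥ 0`, `P = 0 ⇒ V = 0`), then `min (3V²/(392·P)) (|V|/80) ≤ X`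
(interior optimum `σ = 3V/(49P)` when `|V| ≤ 49P/30`, else the endpoint `σ = ±1/10`). -/
theorem dirCharge_of_family {X V P : ℝ} (hP : 0 ≤ P) (hPV : P = 0 → V = 0)
    (h : ∀ σ : ℝ, |σ| ≤ 1 / 10 → 0 ≤ X - σ * (V / 4) + (49 / 24) * σ ^ 2 * P) :
    min (3 * V ^ 2 / (392 * P)) (|V| / 80) ≤ X := by
  have h0 := h 0 (by norm_num)
  have hX : 0 ≤ X := by linarith
  by_cases hP0 : P = 0
  · have hV0 := hPV hP0
    rw [hP0, hV0]
    norm_num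
    exact hX
  have hPpos : 0 < P := lt_of_le_of_ne hP (Ne.symm hP0)
  by_cases hV : |V| ≤ 49 * P / 30
  · -- interior optimum
    refine min_le_of_left_le ?_
    have hσ : |3 * V / (49 * P)| ≤ 1 / 10 := by
      rw [abs_div, abs_mul, abs_of_pos (by norm_num : (0 : ℝ) < 3), abs_of_pos (by positivity : (0 : ℝ) < 49 * P),
        div_le_iff₀ (by positivity : (0 : ℝ) < 49 * P)]
      linarith
    have h1 := h (3 * V / (49 * P)) hσ
    have key : 3 * V / (49 * P) * (V / 4) - (49 / 24) * (3 * V / (49 * P)) ^ 2 * P = 3 * V ^ 2 / (392 * P) := by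
      field_simp
      ring
    linarith [key]
  · -- endpoint
    refine min_le_of_right_le ?_
    have hV' : 49 * P / 30 < |V| := lt_of_not_ge hV
    have hP' : (49 / 2400) * P < |V| / 80 := by linarith
    by_cases hV0 : 0 ≤ V
    · have h1 := h (1 / 10) (by rw [abs_of_pos (by norm_num : (0 : ℝ) < 1 / 10)])
      rw [abs_of_nonneg hV0] at hP' ⊢
      nlinarith
    · have hVneg : V < 0 := lt_of_not_ge hV0
      have h1 := h (-(1 / 10)) (by rw [abs_neg, abs_of_pos (by norm_num : (0 : ℝ) < 1 / 10)])
      rw [abs_of_neg hVneg] at hP' ⊢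
      nlinarith

/-- The two directional lattice sums vanish together (`P = 0 ⇒ V = 0` for the optimisation). -/
theorem dirSum_twelve_eq_zero {N : ℕ} (y : Fin N → EuclideanSpace ℝ (Fin 3)) (W : Finset (Fin N))
    (u : EuclideanSpace ℝ (Fin 3))
    (h : ∑ i ∈ W, ∑ k ∈ W.erase i, (dist (y i) (y k))⁻¹ ^ 12 * (inner ℝ u (y k - y i) / dist (y i) (y k)) ^ 2 = 0) :
    ∑ i ∈ W, ∑ k ∈ W.erase i, (dist (y i) (y k))⁻¹ ^ 6 * (inner ℝ u (y k - y i) / dist (y i) (y k)) ^ 2 = 0 := by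
  rw [Finset.sum_eq_zero_iff_of_nonneg fun i _ => Finset.sum_nonneg fun k _ => by positivity] at h ⊢
  intro i hi
  have hi' := h i hi
  rw [Finset.sum_eq_zero_iff_of_nonneg fun k _ => by positivity] at hi' ⊢
  intro k hk
  have hk' := hi' k hk
  rcases mul_eq_zero.1 hk' with h1 | h2
  · rw [(pow_eq_zero_iff (by norm_num : (12 : ℕ) ≠ 0)).1 h1, zero_pow (by norm_num), zero_mul]
  · rw [h2, mul_zero]

/-- **THE DIRECTIONAL CHARGE** (second rung of the strain-mode ladder; configuration-free, `e⋆`-free): for distinct points `y`,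
EVERY index set `W` and EVERY unit vector `u`, with `Vᵘ = D₁₂ᵘ(W) − D₆ᵘ(W)` the directional (uniaxial) virial,
`min (3·(Vᵘ)²/(392·D₁₂ᵘ)) (|Vᵘ|/80) ≤ 𝓔(y|W) − #W·e⋆`.
The excess of a window over the bulk floor controls its UNIAXIAL virial in every direction, not only its trace (the dilation
charge): a sub-window whose directional lattice sums are unbalanced in some direction pays for it. -/
theorem directionalCharge_le {N : ℕ} {y : Fin N → EuclideanSpace ℝ (Fin 3)} (hy : Function.Injective y)
    (W : Finset (Fin N)) {u : EuclideanSpace ℝ (Fin 3)} (hu : ‖u‖ = 1) :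
    min (3 * ((∑ i ∈ W, ∑ k ∈ W.erase i, (dist (y i) (y k))⁻¹ ^ 12 * (inner ℝ u (y k - y i) / dist (y i) (y k)) ^ 2) -
              ∑ i ∈ W, ∑ k ∈ W.erase i, (dist (y i) (y k))⁻¹ ^ 6 * (inner ℝ u (y k - y i) / dist (y i) (y k)) ^ 2) ^ 2 /
            (392 * ∑ i ∈ W, ∑ k ∈ W.erase i, (dist (y i) (y k))⁻¹ ^ 12 * (inner ℝ u (y k - y i) / dist (y i) (y k)) ^ 2))
        (|(∑ i ∈ W, ∑ k ∈ W.erase i, (dist (y i) (y k))⁻¹ ^ 12 * (inner ℝ u (y k - y i) / dist (y i) (y k)) ^ 2) -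
            ∑ i ∈ W, ∑ k ∈ W.erase i, (dist (y i) (y k))⁻¹ ^ 6 * (inner ℝ u (y k - y i) / dist (y i) (y k)) ^ 2| / 80) ≤
      (1 / 2) * ∑ i ∈ W, ∑ k ∈ W.erase i, lennardJones (dist (y i) (y k)) -
        (W.card : ℝ) * (⨅ Q : PeriodicConfiguration 3, Q.energyPerParticle lennardJones) := by
  set P : ℝ := ∑ i ∈ W, ∑ k ∈ W.erase i, (dist (y i) (y k))⁻¹ ^ 12 * (inner ℝ u (y k - y i) / dist (y i) (y k)) ^ 2
    with hPdef
  set R : ℝ := ∑ i ∈ W, ∑ k ∈ W.erase i, (dist (y i) (y k))⁻¹ ^ 6 * (inner ℝ u (y k - y i) / dist (y i) (y k)) ^ 2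
    with hRdef
  have hP0 : 0 ≤ P := by
    rw [hPdef]
    exact Finset.sum_nonneg fun i _ => Finset.sum_nonneg fun k _ => by positivity
  refine dirCharge_of_family (V := P - R) (P := P) hP0 (fun h0 => ?_) fun σ hσ => ?_
  · have hR : R = 0 := by
      rw [hRdef]
      exact dirSum_twelve_eq_zero y W u (by rw [hPdef] at h0; exact h0)
    rw [h0, hR, sub_zero]
  · have h : (W.card : ℝ) * (⨅ Q : PeriodicConfiguration 3, Q.energyPerParticle lennardJones) ≤
        (1 / 2) * ∑ i ∈ W, ∑ k ∈ W.erase i, lennardJones (dist (y i) (y k)) + σ * ((1 / 4) * (R - P)) +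
          (49 / 24) * σ ^ 2 * P :=
      card_mul_iInf_le_stretch hy W hu hσ
    linarith

/-! ## §6 Separated form -/

/-- Shell bound for the attractive lattice sum: at separation `δ`, `S₆(W) ≤ 250·δ⁻⁶·#W` (Literature shell sum, summed over `W`). -/
theorem sum_inv_pow_six_le_of_separated {N : ℕ} (y : Fin N → EuclideanSpace ℝ (Fin 3)) (W : Finset (Fin N))
    {δ : ℝ} (hδ : 0 < δ) (hsep : ∀ k l : Fin N, k ≠ l → δ ≤ dist (y k) (y l)) :
    ∑ i ∈ W, ∑ k ∈ W.erase i, (dist (y i) (y k))⁻¹ ^ 6 ≤ 250 * δ⁻¹ ^ 6 * (W.card : ℝ) := by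
  have hi : ∀ i ∈ W, ∑ k ∈ W.erase i, (dist (y i) (y k))⁻¹ ^ 6 ≤ 250 * δ⁻¹ ^ 6 := by
    intro i _
    calc ∑ k ∈ W.erase i, (dist (y i) (y k))⁻¹ ^ 6
        ≤ ∑ k ∈ Finset.univ.erase i, (dist (y i) (y k))⁻¹ ^ 6 :=
          Finset.sum_le_sum_of_subset_of_nonneg (Finset.erase_subset_erase i (Finset.subset_univ W))
            fun _ _ _ => by positivity
      _ ≤ 250 * δ⁻¹ ^ 6 := sum_inv_pow_six_le y hδ hsep i
  calc ∑ i ∈ W, ∑ k ∈ W.erase i, (dist (y i) (y k))⁻¹ ^ 6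
      ≤ ∑ i ∈ W, 250 * δ⁻¹ ^ 6 := Finset.sum_le_sum hi
    _ = 250 * δ⁻¹ ^ 6 * (W.card : ℝ) := by rw [Finset.sum_const, nsmul_eq_mul]; ring

/-- Directional sums are dominated by the plain lattice sums (`cos² ≤ 1` termwise). -/
theorem dirSum_le_sum {N : ℕ} (y : Fin N → EuclideanSpace ℝ (Fin 3)) (W : Finset (Fin N))
    {u : EuclideanSpace ℝ (Fin 3)} (hu : ‖u‖ = 1) (n : ℕ) :
    ∑ i ∈ W, ∑ k ∈ W.erase i, (dist (y i) (y k))⁻¹ ^ n * (inner ℝ u (y k - y i) / dist (y i) (y k)) ^ 2 ≤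
      ∑ i ∈ W, ∑ k ∈ W.erase i, (dist (y i) (y k))⁻¹ ^ n := by
  refine Finset.sum_le_sum fun i _ => Finset.sum_le_sum fun k _ => ?_
  calc (dist (y i) (y k))⁻¹ ^ n * (inner ℝ u (y k - y i) / dist (y i) (y k)) ^ 2
      ≤ (dist (y i) (y k))⁻¹ ^ n * 1 := mul_le_mul_of_nonneg_left (dirCos_sq_le_one hu (y i) (y k)) (by positivity)
    _ = (dist (y i) (y k))⁻¹ ^ n := mul_one _

/-- **Separated form of the directional charge.**  For `δ`-separated distinct points, every index set `W` and every unit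
vector `u`:  `(D₁₂ᵘ(W) − D₆ᵘ(W))² ≤ 33000·(δ⁻¹² + δ⁻⁶)·#W·(𝓔(y|W) − #W·e⋆)`. -/
theorem dirVirial_sq_le_of_separated {N : ℕ} {y : Fin N → EuclideanSpace ℝ (Fin 3)} (hy : Function.Injective y)
    (W : Finset (Fin N)) {u : EuclideanSpace ℝ (Fin 3)} (hu : ‖u‖ = 1) {δ : ℝ} (hδ : 0 < δ)
    (hsep : ∀ k l : Fin N, k ≠ l → δ ≤ dist (y k) (y l)) :
    ((∑ i ∈ W, ∑ k ∈ W.erase i, (dist (y i) (y k))⁻¹ ^ 12 * (inner ℝ u (y k - y i) / dist (y i) (y k)) ^ 2) -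
        ∑ i ∈ W, ∑ k ∈ W.erase i, (dist (y i) (y k))⁻¹ ^ 6 * (inner ℝ u (y k - y i) / dist (y i) (y k)) ^ 2) ^ 2 ≤
      33000 * (δ⁻¹ ^ 12 + δ⁻¹ ^ 6) * (W.card : ℝ) *
        ((1 / 2) * ∑ i ∈ W, ∑ k ∈ W.erase i, lennardJones (dist (y i) (y k)) -
          (W.card : ℝ) * (⨅ Q : PeriodicConfiguration 3, Q.energyPerParticle lennardJones)) := by
  set P : ℝ := ∑ i ∈ W, ∑ k ∈ W.erase i, (dist (y i) (y k))⁻¹ ^ 12 * (inner ℝ u (y k - y i) / dist (y i) (y k)) ^ 2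
    with hPdef
  set R : ℝ := ∑ i ∈ W, ∑ k ∈ W.erase i, (dist (y i) (y k))⁻¹ ^ 6 * (inner ℝ u (y k - y i) / dist (y i) (y k)) ^ 2
    with hRdef
  set X : ℝ := (1 / 2) * ∑ i ∈ W, ∑ k ∈ W.erase i, lennardJones (dist (y i) (y k)) -
    (W.card : ℝ) * (⨅ Q : PeriodicConfiguration 3, Q.energyPerParticle lennardJones) with hXdef
  have hc : min (3 * (P - R) ^ 2 / (392 * P)) (|P - R| / 80) ≤ X := directionalCharge_le hy W hu
  have hX : 0 ≤ X := windowExcess_nonneg hy W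
  have hP12 : P ≤ 250 * δ⁻¹ ^ 12 * (W.card : ℝ) :=
    le_trans (dirSum_le_sum y W hu 12) (sum_inv_pow_twelve_le_of_separated y W hδ hsep)
  have hP6 : R ≤ 250 * δ⁻¹ ^ 6 * (W.card : ℝ) :=
    le_trans (dirSum_le_sum y W hu 6) (sum_inv_pow_six_le_of_separated y W hδ hsep)
  have hP0 : 0 ≤ P := by
    rw [hPdef]
    exact Finset.sum_nonneg fun i _ => Finset.sum_nonneg fun k _ => by positivity
  have hR0 : 0 ≤ R := by
    rw [hRdef]
    exact Finset.sum_nonneg fun i _ => Finset.sum_nonneg fun k _ => by positivity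
  have hW0 : (0 : ℝ) ≤ (W.card : ℝ) := by positivity
  have hδ12 : (0 : ℝ) ≤ δ⁻¹ ^ 12 := by positivity
  have hδ6 : (0 : ℝ) ≤ δ⁻¹ ^ 6 := by positivity
  have habs : |P - R| ≤ 250 * (δ⁻¹ ^ 12 + δ⁻¹ ^ 6) * (W.card : ℝ) := by
    rw [abs_le]
    constructor <;> nlinarith
  rcases min_le_iff.1 hc with h1 | h2
  · by_cases hP00 : P = 0
    · have hR00 : R = 0 := by rw [hRdef]; exact dirSum_twelve_eq_zero y W u (by rw [← hPdef]; exact hP00)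
      rw [hP00, hR00]
      have : (0 : ℝ) ≤ 33000 * (δ⁻¹ ^ 12 + δ⁻¹ ^ 6) * (W.card : ℝ) * X := mul_nonneg (by positivity) hX
      simpa using this
    · have hPpos : 0 < P := lt_of_le_of_ne hP0 (Ne.symm hP00)
      rw [div_le_iff₀ (by linarith : (0 : ℝ) < 392 * P)] at h1
      calc (P - R) ^ 2 ≤ (392 / 3) * P * X := by nlinarith
        _ ≤ (392 / 3) * (250 * δ⁻¹ ^ 12 * (W.card : ℝ)) * X := by
            refine mul_le_mul_of_nonneg_right (mul_le_mul_of_nonneg_left hP12 (by norm_num)) hX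
        _ ≤ 33000 * (δ⁻¹ ^ 12 + δ⁻¹ ^ 6) * (W.card : ℝ) * X := by
            nlinarith [mul_nonneg (mul_nonneg hδ6 hW0) hX, mul_nonneg (mul_nonneg hδ12 hW0) hX]
  · rw [div_le_iff₀ (by norm_num : (0 : ℝ) < 80)] at h2
    calc (P - R) ^ 2 = |P - R| * |P - R| := by rw [← sq, sq_abs]
      _ ≤ (250 * (δ⁻¹ ^ 12 + δ⁻¹ ^ 6) * (W.card : ℝ)) * (X * 80) :=
          mul_le_mul habs h2 (abs_nonneg _) (by positivity)
      _ ≤ 33000 * (δ⁻¹ ^ 12 + δ⁻¹ ^ 6) * (W.card : ℝ) * X := by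
          nlinarith [mul_nonneg (mul_nonneg hδ6 hW0) hX, mul_nonneg (mul_nonneg hδ12 hW0) hX]

/-! ## §7 GS grade: local zero deviatoric stress on ground-state windows -/

/-- **Local zero uniaxial stress on ground-state windows.**  For every `ε > 0` there is `ρ₁` such that for all `ρ ≥ ρ₁`,
every Lennard-Jones ground state `y`, every centre `p` and every unit vector `u`, the window `B = B(p,ρ)` satisfies
`|D₁₂ᵘ(B) − D₆ᵘ(B)| ≤ ε·(#B + ρ³)`: together with local zero pressure (`gsWindowVirial_small`) the whole window-averaged
first-order (affine) strain response of a ground-state window vanishes at density `o(1) + O(ρ³/#B)`.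
Inputs: `dirVirial_sq_le_of_separated`, `gsWindow_excess_virial` (excess ceiling on GS windows), the GS minimal distance. -/
theorem gsWindowDirVirial_small : ∀ ε : ℝ, 0 < ε → ∃ ρ₁ : ℝ, ∀ ρ : ℝ, ρ₁ ≤ ρ →
    ∀ (N : ℕ) (y : Fin N → EuclideanSpace ℝ (Fin 3)), IsGroundState lennardJones y → ∀ p : EuclideanSpace ℝ (Fin 3),
      ∀ u : EuclideanSpace ℝ (Fin 3), ‖u‖ = 1 →
      |(∑ i ∈ Finset.univ.filter (fun i : Fin N => dist (y i) p ≤ ρ),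
            ∑ k ∈ (Finset.univ.filter (fun i : Fin N => dist (y i) p ≤ ρ)).erase i,
              (dist (y i) (y k))⁻¹ ^ 12 * (inner ℝ u (y k - y i) / dist (y i) (y k)) ^ 2) -
          ∑ i ∈ Finset.univ.filter (fun i : Fin N => dist (y i) p ≤ ρ),
            ∑ k ∈ (Finset.univ.filter (fun i : Fin N => dist (y i) p ≤ ρ)).erase i,
              (dist (y i) (y k))⁻¹ ^ 6 * (inner ℝ u (y k - y i) / dist (y i) (y k)) ^ 2|
        ≤ ε * (((Finset.univ.filter (fun i : Fin N => dist (y i) p ≤ ρ)).card : ℝ) + ρ ^ 3) := by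
  intro ε hε
  obtain ⟨δ, hδ, hsepGS⟩ := LennardJonesMinimalDistance_holds
  obtain ⟨K, hK⟩ : ∃ K : ℝ, K = 33000 * (δ⁻¹ ^ 12 + δ⁻¹ ^ 6) := ⟨_, rfl⟩
  have hK0 : 0 < K := by rw [hK]; positivity
  obtain ⟨ρ₀, hev⟩ := gsWindow_excess_virial (ε ^ 2 / K) (by positivity)
  refine ⟨max ρ₀ 0, fun ρ hρ N y hGS p u hu => ?_⟩
  have hρ₀ : ρ₀ ≤ ρ := le_trans (le_max_left _ _) hρ
  have hρ0 : 0 ≤ ρ := le_trans (le_max_right _ _) hρ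
  have hy : Function.Injective y := hGS.1
  have hsep : ∀ k l : Fin N, k ≠ l → δ ≤ dist (y k) (y l) := hsepGS N y hGS
  set B : Finset (Fin N) := Finset.univ.filter (fun i : Fin N => dist (y i) p ≤ ρ) with hB
  set X : ℝ := (1 / 2) * ∑ i ∈ B, ∑ k ∈ B.erase i, lennardJones (dist (y i) (y k)) -
    (B.card : ℝ) * (⨅ Q : PeriodicConfiguration 3, Q.energyPerParticle lennardJones) with hXdef
  set P : ℝ := ∑ i ∈ B, ∑ k ∈ B.erase i, (dist (y i) (y k))⁻¹ ^ 12 * (inner ℝ u (y k - y i) / dist (y i) (y k)) ^ 2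
    with hPdef
  set R : ℝ := ∑ i ∈ B, ∑ k ∈ B.erase i, (dist (y i) (y k))⁻¹ ^ 6 * (inner ℝ u (y k - y i) / dist (y i) (y k)) ^ 2
    with hRdef
  have hX0 : 0 ≤ X := (hev ρ hρ₀ N y hGS p).1
  have hX1 : X ≤ ε ^ 2 / K * ((B.card : ℝ) + ρ ^ 3) := (hev ρ hρ₀ N y hGS p).2.1
  have hV : (P - R) ^ 2 ≤ K * (B.card : ℝ) * X := by
    rw [hK]
    exact dirVirial_sq_le_of_separated hy B hu hδ hsep
  have hM0 : (0 : ℝ) ≤ (B.card : ℝ) + ρ ^ 3 := by positivity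
  have hV2 : (P - R) ^ 2 ≤ (ε * ((B.card : ℝ) + ρ ^ 3)) ^ 2 := by
    have hcardle : (B.card : ℝ) ≤ (B.card : ℝ) + ρ ^ 3 := by linarith [pow_nonneg hρ0 3]
    have hKB : K * (B.card : ℝ) ≤ K * ((B.card : ℝ) + ρ ^ 3) := mul_le_mul_of_nonneg_left hcardle hK0.le
    have hKε : K * (ε ^ 2 / K) = ε ^ 2 := by field_simp
    calc (P - R) ^ 2 ≤ K * (B.card : ℝ) * X := hV
      _ ≤ K * ((B.card : ℝ) + ρ ^ 3) * X := mul_le_mul_of_nonneg_right hKB hX0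
      _ ≤ K * ((B.card : ℝ) + ρ ^ 3) * (ε ^ 2 / K * ((B.card : ℝ) + ρ ^ 3)) :=
          mul_le_mul_of_nonneg_left hX1 (mul_nonneg hK0.le hM0)
      _ = (K * (ε ^ 2 / K)) * ((B.card : ℝ) + ρ ^ 3) ^ 2 := by ring
      _ = (ε * ((B.card : ℝ) + ρ ^ 3)) ^ 2 := by rw [hKε]; ring
  exact abs_le_of_sq_le_sq hV2 (mul_nonneg hε.le hM0)

end Summit.AtomisticToContinuum.Crystallization.Theorems.ContactSaturationLadderDirectionalCharge
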